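import Summits.HodgeConjecture.HodgeConjecture.Theorems.F0LD2ThetaFinComponent
import Summits.HodgeConjecture.HodgeConjecture.Theorems.F0LD2SameLabelClassesOfLetters
import Summits.HodgeConjecture.HodgeConjecture.Theorems.F0LD1RelativeArchPositivity
import HarnessLib

-- As in the lineage: statements over the theta-kernel datum elaborate to very large types; elaborate sequentially.
set_option Elab.async false

/-!
# Crux `HLiu418`, line LD1 — THE ASSEMBLY OF ORGAN (L) `stub_thetaLinePinned : ThetaLinePinned₂` FROM ITS BRICKS («the line of the theta seam is
# pinned by the finite component and the Hodge type»: finite local classes + archimedean positivity + seam transport)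

Cell hodgecm-mathlib (D-0151), FLOOR 0; crux item `HLiu418` = stmt-HodgeConjecture-24832; half-A line LD1, leaf `Cruxes/HLiu418/Lines/F0_P6LD_StubS1FactsThetaRoad.lean`
(organ (L) `ThetaLinePinned₂` :354).  Seat LD1-p01 (g0), LD1-plan DEAL 2026-09-02T04:38Z (decision (β) 03:42:40Z: the RELATIVE road, no orientation).  THEOREMS
ONLY (no `def`, no instance, no notation, no named fact, no `sorry`); `--supports stmt-HodgeConjecture-24832 --as helper`.  The Lines module is NOT imported
(the leaf's later edition imports THIS file and writes `stub_thetaLinePinned := thetaLinePinned₂_of_bricks ‹U₂″› ‹transport›`): the organ text is the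
CONCLUSION BY VALUE, token for token; the not-yet-★ bricks are HYPOTHESES whose texts are the pens' organ ∕ brick texts.  HC_CM is proved only modulo the 7
printed citations (2 remaining: hLiu418 = stmt-HodgeConjecture-24832, h413 = stmt-HodgeConjecture-24833) until rung 0 closes; nothing printed is discharged here.

THE BRICKS ([Liu2021, Thm. B.4 (2) «`W` is unique up to isomorphism»; proof of Cor. B.6 (3) p. 99; Lem. D.1 (3)(4), Lem. D.2], read relatively for two
discrete `P`, `P′` with the SAME finite component `σ` and the SAME Hodge type at `ι`, meeting the theta lifts from the lines `a′`, `a″`):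
* `hSLC` = LD2's organ U₂″ `SameLabelClasses₂` VERBATIM (the conclusion type of ★ `F0LD2SameLabelClassesOfLetters.sameLabelClasses₂_of_letters hU h4 h1`, LD2-p01):
  a `(1,0)`-type `P` with finite component the θ-type `σ` at the line `a` that ALSO has the θ finite component at the line `a′` has equal local line classes
  `locF a′ = locF a` — fed, for `(P, a′)` and `(P′, a″)`, by ★ B₂ `F0LD2ThetaFinComponent.thetaFinComponent₂_holds` (a seam from the line `a′` + `(1,0)`-type
  ⇒ the θ finite component at `a′` for some `χ′`); so `locF a′ v = locF a v = locF a″ v` at every finite `v` (PROVED here).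
* (★, folded in) `F0LD1RelativeArchPositivity.relArchPositivity₂_holds` (LD1-p02, p849271) = the RELATIVE ARCHIMEDEAN POSITIVITY brick: the two seams with the same Hodge type force `0 < ρ(a′ ∕ a″)` at every real place `ρ` of `L⁺`
  (closer: the de-phased relative `ι`-sign corollary of ★ `F0LD1ArchSignRelative` (LD1-p02) at the place under `ι` + ★ `F0LD2ArchTypeAway.archTypeAway₂_holds`
  at the other places).
* `hLT` = the SEAM TRANSPORT brick (A-p13 (g38): ★ `Liu2021.MeetsThetaLiftFromLine.transport` ∕ `frameTransport` + the `W`-re-indexing + Hasse ★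
  `CMFieldHasseNorm`): a seam from the line `a″` transports to a seam from `a₁` whenever `a₁ ∕ a″` is a local norm at every finite place (equal `locF` classes)
  and positive at every real place.
GLUE (`thetaLinePinned₂_of_bricks`): finite classes (B₂ + `hSLC`, twice, `Eq.trans`) + positivity (★ `relArchPositivity₂_holds`) ⇒ `hLT` carries the seam of `P′` from `a″` to `a′`.

References: [Liu2021] Y. Liu, Camb. J. Math. 9 (2021): App. B Thm. B.4 (2), Cor. B.6 (3) and its proof (p. 98–99); App. D Lem. D.1 (3), (4) (p. 125–127),
Lem. D.2 (1), (3); proof of Prop. D.4 (1) (p. 131).  [HarrisKudlaSweet1996] M. Harris, S. Kudla, W. J. Sweet, JAMS 9 (1996), Thm. 6.1.  [Omeara1963]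
O. T. O'Meara (1963), §65:23, §71.  [BorelJacquet1979] A. Borel, H. Jacquet, PSPM 33.1 (1979), §4.6.
-/

set_option autoImplicit false
-- the mandated namespace has the single-problem summit's repeated segment (`HodgeConjecture.HodgeConjecture`)
set_option linter.dupNamespace false

noncomputable section

open scoped Matrix ComplexOrder
open NumberField NumberField.InfinitePlace IsDedekindDomain MeasureTheory
open Literature.NumberTheory.Automorphic Literature.NumberTheory.Automorphic.UnitaryGroup
open Literature.NumberTheory.Automorphic.UnitaryCurveForms
open Literature.NumberTheory.Automorphic.Liu2021 Literature.NumberTheory.Automorphic.Liu2021.Def411WeilCarriers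
open Literature.NumberTheory.Automorphic.Liu2021.Def411WeilCarriersDoubling
open Literature.NumberTheory.Automorphic.Liu2021.LemD1RankTwoCMLetters
open Literature.NumberTheory.GaloisRepresentations Literature.NumberTheory.Automorphic.IdeleClassGroup
open Literature.NumberTheory.GelbartRogawski1991 Literature.NumberTheory.GelbartRogawski1991.UnitaryDualPair
open Literature.RepresentationTheory.Liu2021 Literature.RepresentationTheory.HarrisKudlaSweet1996

namespace Summit.HodgeConjecture.HodgeConjecture.Cruxes.HLiu418.F0LD1ThetaLinePinnedOfBricks

set_option maxHeartbeats 1600000 in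
-- (statement size: two organ-sized hypotheses and an organ-sized conclusion)
/-- **ORGAN (L) `ThetaLinePinned₂` OF THE LD1 θ-ROAD FROM ITS BRICKS** (texts: module docstring).  Conclusion = the body of the leaf's `ThetaLinePinned₂`
(`Lines/F0_P6LD_StubS1FactsThetaRoad.lean` :354–:395) token for token: for the letter's data, a pinned transport `ιA`, `[U(diag dV)]` compact, discrete `P`, `P′`
both `(1,0)`-type at `ι` with the θ-type finite component `σ`, and lines `a′`, `a″`: `Meets(P, λ, a′, ιA) → Meets(P′, λ, a″, ιA) → Meets(P′, λ, a′, ιA)`.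
[cite: Liu2021, App. B Thm. B.4 (2) p. 98; Cor. B.6 (3) and its proof p. 99; App. D Lem. D.1 (3), (4) p. 125–127; proof of Prop. D.4 (1) p. 131]
[cite: HarrisKudlaSweet1996, Thm. 6.1] [cite: Omeara1963, §65:23, §71] -/
theorem thetaLinePinned₂_of_bricks
    (hSLC : ∀ (L : Type) [Field L] [NumberField L] [IsCMField L] (ι : L →+* ℂ) (H : Matrix (Fin 2) (Fin 2) L)
        (dV : Fin 2 → L) (hdV : ∀ i, IsCMField.complexConj L (dV i) = dV i) (hdV0 : ∀ i, dV i ≠ 0)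
        (t : L) (ht : t ≠ 0) (g : GL (Fin 2) L)
        (hg : formCongr ((IsCMField.complexConj L : L ≃ₐ[↥(maximalRealSubfield L)] L) : L →+* L) g (t • H) = Matrix.diagonal dV),
        (∃ T : GL (Fin 2) ℂ, formCongr (starRingEnd ℂ) T ((Matrix.diagonal dV).map ι) = Matrix.diagonal ![(1 : ℂ), -1]) →
        (∀ τ' : L →+* ℂ, InfinitePlace.mk τ' ≠ InfinitePlace.mk ι → ((Matrix.diagonal dV).map τ').PosDef) →
        4 ≤ Module.finrank ℚ L →
        ∀ (𝔣 : ConeFrame L H (cmPlace L ι))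
          (μ : Measure (adelicGroupData (↥(maximalRealSubfield L)) L (IsCMField.complexConj L) 2 H).automorphicQuotient)
          [(adelicGroupData (↥(maximalRealSubfield L)) L (IsCMField.complexConj L) 2 H).IsAutomorphicMeasure μ]
          {n' : ℕ} (e₁ : Fin 2 × Fin 1 ≃ Fin n')
          (lam : Literature.NumberTheory.Automorphic.IdeleClassGroup L →ₜ* Circle) (hlam : IsConjugateSymplectic L lam), HasWeight L lam 1 →
        ∀ (a : (↥(maximalRealSubfield L))ˣ) (χ : Chi (↥(maximalRealSubfield L)) L (IsCMField.complexConj L))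
          (W : Type) [AddCommGroup W] [Module ℂ W]
          (σ : Representation ℂ (finAdelic (↥(maximalRealSubfield L)) L (IsCMField.complexConj L) 2 H) W),
          σ.IsIrreducible → σ.IsSmooth →
        ∀ j : σ.IntertwiningMap
            ((rhoVAtLine (↥(maximalRealSubfield L)) L (IsCMField.complexConj L) 2 e₁ (Matrix.diagonal dV)
                (complexConj_imagUnit L) (imagUnit_ne_zero L) (imagUnit_mul_self L) (realDiagonal_isSymm L dV hdV)
                (isUnit_det_realDiagonal L dV hdV hdV0) (realDiagonal_map L dV hdV).symm
                (fun a => isCompatible_chiSplittingLine L e₁ dV hdV hdV0 (toHeckeCharacter L lam)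
                  (isUnitary_toHeckeCharacter L lam) ((isOscillatorChar_toHeckeCharacter_iff lam).mpr hlam)
                  (TW (↥(maximalRealSubfield L)) a) (isSymm_TW (↥(maximalRealSubfield L)) a)
                  (isUnit_det_TW (↥(maximalRealSubfield L)) a) (JW (↥(maximalRealSubfield L)) L a)
                  (JW_eq (↥(maximalRealSubfield L)) L a)) a χ).comp
              (finAdelicCongr (↥(maximalRealSubfield L)) L (IsCMField.complexConj L) g ht hg).symm.toMonoidHom),
          Function.Injective j →
        ∀ P : DiscreteAutomorphicRep (adelicGroupData (↥(maximalRealSubfield L)) L (IsCMField.complexConj L) 2 H) μ,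
          P.IsHolCotangentAt₂ (IsCMField.complexConj_ne_one L) (UnitaryGroup.complexConj_smul_infinitePlace L) (cmPlace L ι) 𝔣 →
          P.HasFinComponent σ →
        ∀ (a' : (↥(maximalRealSubfield L))ˣ) (χ' : Chi (↥(maximalRealSubfield L)) L (IsCMField.complexConj L)),
          Nontrivial
            (omegaAtLine (↥(maximalRealSubfield L)) L (IsCMField.complexConj L) 2 e₁ (Matrix.diagonal dV)
                (complexConj_imagUnit L) (imagUnit_ne_zero L) (imagUnit_mul_self L) (realDiagonal_isSymm L dV hdV)
                (isUnit_det_realDiagonal L dV hdV hdV0) (realDiagonal_map L dV hdV).symm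
                (fun a => isCompatible_chiSplittingLine L e₁ dV hdV hdV0 (toHeckeCharacter L lam)
                  (isUnitary_toHeckeCharacter L lam) ((isOscillatorChar_toHeckeCharacter_iff lam).mpr hlam)
                  (TW (↥(maximalRealSubfield L)) a) (isSymm_TW (↥(maximalRealSubfield L)) a)
                  (isUnit_det_TW (↥(maximalRealSubfield L)) a) (JW (↥(maximalRealSubfield L)) L a)
                  (JW_eq (↥(maximalRealSubfield L)) L a)) a' χ') →
          P.HasFinComponent
              ((rhoVAtLine (↥(maximalRealSubfield L)) L (IsCMField.complexConj L) 2 e₁ (Matrix.diagonal dV)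
                  (complexConj_imagUnit L) (imagUnit_ne_zero L) (imagUnit_mul_self L) (realDiagonal_isSymm L dV hdV)
                  (isUnit_det_realDiagonal L dV hdV hdV0) (realDiagonal_map L dV hdV).symm
                  (fun a => isCompatible_chiSplittingLine L e₁ dV hdV hdV0 (toHeckeCharacter L lam)
                    (isUnitary_toHeckeCharacter L lam) ((isOscillatorChar_toHeckeCharacter_iff lam).mpr hlam)
                    (TW (↥(maximalRealSubfield L)) a) (isSymm_TW (↥(maximalRealSubfield L)) a)
                    (isUnit_det_TW (↥(maximalRealSubfield L)) a) (JW (↥(maximalRealSubfield L)) L a)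
                    (JW_eq (↥(maximalRealSubfield L)) L a)) a' χ').comp
                (finAdelicCongr (↥(maximalRealSubfield L)) L (IsCMField.complexConj L) g ht hg).symm.toMonoidHom) →
          ∀ v : HeightOneSpectrum (𝓞 ↥(maximalRealSubfield L)),
            locF (↥(maximalRealSubfield L)) (imagUnitSq L) a' v = locF (↥(maximalRealSubfield L)) (imagUnitSq L) a v)
    (hLT : ∀ (L : Type) [Field L] [NumberField L] [IsCMField L] (ι : L →+* ℂ) (H : Matrix (Fin 2) (Fin 2) L)
        (dV : Fin 2 → L) (hdV : ∀ i, IsCMField.complexConj L (dV i) = dV i) (hdV0 : ∀ i, dV i ≠ 0)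
        (t : L) (ht : t ≠ 0) (g : GL (Fin 2) L)
        (hg : formCongr ((IsCMField.complexConj L : L ≃ₐ[↥(maximalRealSubfield L)] L) : L →+* L) g (t • H) = Matrix.diagonal dV),
        (∃ T : GL (Fin 2) ℂ, formCongr (starRingEnd ℂ) T ((Matrix.diagonal dV).map ι) = Matrix.diagonal ![(1 : ℂ), -1]) →
        (∀ τ' : L →+* ℂ, InfinitePlace.mk τ' ≠ InfinitePlace.mk ι → ((Matrix.diagonal dV).map τ').PosDef) →
        4 ≤ Module.finrank ℚ L →
        ∀ (μ : Measure (adelicGroupData (↥(maximalRealSubfield L)) L (IsCMField.complexConj L) 2 H).automorphicQuotient)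
          [(adelicGroupData (↥(maximalRealSubfield L)) L (IsCMField.complexConj L) 2 H).IsAutomorphicMeasure μ]
          {n' : ℕ} (e₁ : Fin 2 × Fin 1 ≃ Fin n')
          (lam : Literature.NumberTheory.Automorphic.IdeleClassGroup L →ₜ* Circle) (hlam : IsConjugateSymplectic L lam), HasWeight L lam 1 →
        ∀ (ιA : (adelicGroupData (↥(maximalRealSubfield L)) L (IsCMField.complexConj L) 2 H).Adelic →*
            ↥(UnitaryGroup.adelic (↥(maximalRealSubfield L)) L (IsCMField.complexConj L) 2 (Matrix.diagonal dV))),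
          (∀ k, ((ιA k : ↥(UnitaryGroup.adelic (↥(maximalRealSubfield L)) L (IsCMField.complexConj L) 2 (Matrix.diagonal dV))) :
                GL (Fin 2) (AdeleRing (𝓞 L) L)) =
              (toAdeleGL L g)⁻¹ * adelicVal (↥(maximalRealSubfield L)) L (IsCMField.complexConj L) 2 H k * toAdeleGL L g) →
        ∀ [CompactSpace (↥(UnitaryGroup.adelic (↥(maximalRealSubfield L)) L (IsCMField.complexConj L) 2 (Matrix.diagonal dV)) ⧸
            (UnitaryGroup.toAdelic (↥(maximalRealSubfield L)) L (IsCMField.complexConj L) 2 (Matrix.diagonal dV)).range)],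
        ∀ (P : DiscreteAutomorphicRep (adelicGroupData (↥(maximalRealSubfield L)) L (IsCMField.complexConj L) 2 H) μ) (a'' a₁ : (↥(maximalRealSubfield L))ˣ),
          MeetsThetaLiftFromLine L 2 H e₁ dV hdV hdV0 P lam hlam a'' ιA →
          (∀ v : HeightOneSpectrum (𝓞 (↥(maximalRealSubfield L))),
            locF (↥(maximalRealSubfield L)) (imagUnitSq L) a₁ v = locF (↥(maximalRealSubfield L)) (imagUnitSq L) a'' v) →
          (∀ ρ : (↥(maximalRealSubfield L)) →+* ℝ, 0 < ρ ((a₁ : (↥(maximalRealSubfield L))) * ((a'' : (↥(maximalRealSubfield L))))⁻¹)) →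
          MeetsThetaLiftFromLine L 2 H e₁ dV hdV hdV0 P lam hlam a₁ ιA) :
    ∀ (L : Type) [Field L] [NumberField L] [IsCMField L] (ι : L →+* ℂ) (H : Matrix (Fin 2) (Fin 2) L)
      (dV : Fin 2 → L) (hdV : ∀ i, IsCMField.complexConj L (dV i) = dV i) (hdV0 : ∀ i, dV i ≠ 0)
      (t : L) (ht : t ≠ 0) (g : GL (Fin 2) L)
      (hg : formCongr ((IsCMField.complexConj L : L ≃ₐ[↥(maximalRealSubfield L)] L) : L →+* L) g (t • H) = Matrix.diagonal dV),
      (∃ T : GL (Fin 2) ℂ, formCongr (starRingEnd ℂ) T ((Matrix.diagonal dV).map ι) = Matrix.diagonal ![(1 : ℂ), -1]) →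
      (∀ τ' : L →+* ℂ, InfinitePlace.mk τ' ≠ InfinitePlace.mk ι → ((Matrix.diagonal dV).map τ').PosDef) →
      4 ≤ Module.finrank ℚ L →
      ∀ (𝔣 : ConeFrame L H (cmPlace L ι))
        (μ : Measure (adelicGroupData (↥(maximalRealSubfield L)) L (IsCMField.complexConj L) 2 H).automorphicQuotient)
        [(adelicGroupData (↥(maximalRealSubfield L)) L (IsCMField.complexConj L) 2 H).IsAutomorphicMeasure μ]
        {n' : ℕ} (e₁ : Fin 2 × Fin 1 ≃ Fin n')
        (lam : Literature.NumberTheory.Automorphic.IdeleClassGroup L →ₜ* Circle) (hlam : IsConjugateSymplectic L lam), HasWeight L lam 1 →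
      ∀ (a : (↥(maximalRealSubfield L))ˣ) (χ : Chi (↥(maximalRealSubfield L)) L (IsCMField.complexConj L))
        (W : Type) [AddCommGroup W] [Module ℂ W]
        (σ : Representation ℂ (finAdelic (↥(maximalRealSubfield L)) L (IsCMField.complexConj L) 2 H) W),
        σ.IsIrreducible → σ.IsSmooth →
      ∀ j : σ.IntertwiningMap
          ((rhoVAtLine (↥(maximalRealSubfield L)) L (IsCMField.complexConj L) 2 e₁ (Matrix.diagonal dV)
              (complexConj_imagUnit L) (imagUnit_ne_zero L) (imagUnit_mul_self L) (realDiagonal_isSymm L dV hdV)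
              (isUnit_det_realDiagonal L dV hdV hdV0) (realDiagonal_map L dV hdV).symm
              (fun a => isCompatible_chiSplittingLine L e₁ dV hdV hdV0 (toHeckeCharacter L lam)
                (isUnitary_toHeckeCharacter L lam) ((isOscillatorChar_toHeckeCharacter_iff lam).mpr hlam)
                (TW (↥(maximalRealSubfield L)) a) (isSymm_TW (↥(maximalRealSubfield L)) a)
                (isUnit_det_TW (↥(maximalRealSubfield L)) a) (JW (↥(maximalRealSubfield L)) L a)
                (JW_eq (↥(maximalRealSubfield L)) L a)) a χ).comp
            (finAdelicCongr (↥(maximalRealSubfield L)) L (IsCMField.complexConj L) g ht hg).symm.toMonoidHom),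
        Function.Injective j →
      ∀ (ιA : (adelicGroupData (↥(maximalRealSubfield L)) L (IsCMField.complexConj L) 2 H).Adelic →*
          ↥(UnitaryGroup.adelic (↥(maximalRealSubfield L)) L (IsCMField.complexConj L) 2 (Matrix.diagonal dV))),
        (∀ k, ((ιA k : ↥(UnitaryGroup.adelic (↥(maximalRealSubfield L)) L (IsCMField.complexConj L) 2 (Matrix.diagonal dV))) :
              GL (Fin 2) (AdeleRing (𝓞 L) L)) =
            (toAdeleGL L g)⁻¹ * adelicVal (↥(maximalRealSubfield L)) L (IsCMField.complexConj L) 2 H k * toAdeleGL L g) →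
      ∀ [CompactSpace (↥(UnitaryGroup.adelic (↥(maximalRealSubfield L)) L (IsCMField.complexConj L) 2 (Matrix.diagonal dV)) ⧸
          (UnitaryGroup.toAdelic (↥(maximalRealSubfield L)) L (IsCMField.complexConj L) 2 (Matrix.diagonal dV)).range)],
      ∀ P P' : DiscreteAutomorphicRep (adelicGroupData (↥(maximalRealSubfield L)) L (IsCMField.complexConj L) 2 H) μ,
        P.IsHolCotangentAt₂ (IsCMField.complexConj_ne_one L) (UnitaryGroup.complexConj_smul_infinitePlace L) (cmPlace L ι) 𝔣 →
        P'.IsHolCotangentAt₂ (IsCMField.complexConj_ne_one L) (UnitaryGroup.complexConj_smul_infinitePlace L) (cmPlace L ι) 𝔣 →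
        P.HasFinComponent σ → P'.HasFinComponent σ →
      ∀ (a' a'' : (↥(maximalRealSubfield L))ˣ),
        MeetsThetaLiftFromLine L 2 H e₁ dV hdV hdV0 P lam hlam a' ιA → MeetsThetaLiftFromLine L 2 H e₁ dV hdV hdV0 P' lam hlam a'' ιA →
        MeetsThetaLiftFromLine L 2 H e₁ dV hdV hdV0 P' lam hlam a' ιA := by
  intro L _ _ _ ι H dV hdV hdV0 t ht g hg hsig hdef h4 𝔣 μ _ n' e₁ lam hlam hw a χ W _ _ σ hirr hsm j hj ιA hιA _ P P' hP hP' hPσ hP'σ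
    a' a'' hmeet hmeet'
  -- the finite components of `P`, `P′` realised from the lines `a′`, `a″` (★ B₂)
  obtain ⟨χ', hnt', hfc'⟩ := F0LD2ThetaFinComponent.thetaFinComponent₂_holds L ι H dV hdV hdV0 t ht g hg hsig hdef h4 𝔣 μ e₁ ιA hιA
    P lam hlam a' hmeet hP
  obtain ⟨χ'', hnt'', hfc''⟩ := F0LD2ThetaFinComponent.thetaFinComponent₂_holds L ι H dV hdV hdV0 t ht g hg hsig hdef h4 𝔣 μ e₁ ιA hιA
    P' lam hlam a'' hmeet' hP'
  -- hence the local line classes of `a′` and `a″` both agree with those of `a` (U₂″)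
  have h₁ := hSLC L ι H dV hdV hdV0 t ht g hg hsig hdef h4 𝔣 μ e₁ lam hlam hw a χ W σ hirr hsm j hj P hP hPσ a' χ' hnt' hfc'
  have h₂ := hSLC L ι H dV hdV hdV0 t ht g hg hsig hdef h4 𝔣 μ e₁ lam hlam hw a χ W σ hirr hsm j hj P' hP' hP'σ a'' χ'' hnt'' hfc''
  have hfin : ∀ v : HeightOneSpectrum (𝓞 (↥(maximalRealSubfield L))),
      locF (↥(maximalRealSubfield L)) (imagUnitSq L) a' v = locF (↥(maximalRealSubfield L)) (imagUnitSq L) a'' v := fun v => (h₁ v).trans (h₂ v).symm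
  -- archimedean positivity of `a′ ∕ a″`
  have hpos := F0LD1RelativeArchPositivity.relArchPositivity₂_holds L ι H dV hdV hdV0 t ht g hg hsig hdef h4 𝔣 μ e₁ lam hlam hw ιA hιA
    P P' hP hP' a' a'' hmeet hmeet'
  -- transport `P′`'s seam from `a″` to `a′`
  exact hLT L ι H dV hdV hdV0 t ht g hg hsig hdef h4 μ e₁ lam hlam hw ιA hιA P' a'' a' hmeet' hfin hpos

end Summit.HodgeConjecture.HodgeConjecture.Cruxes.HLiu418.F0LD1ThetaLinePinnedOfBricks

end
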